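import Mathlib
import HarnessLib
import Summits.HubbardSuperconductivity.HubbardSuperconductivity.Theorems.KLProgrammeKLRegimeEnginePlaneWavePhases
import Summits.HubbardSuperconductivity.HubbardSuperconductivity.Theorems.KLProgrammeKLRegimeEngineMomentumMassConserving

/-!
# Route `KLProgramme` — ENGINE item stmt-HubbardSuperconductivity-20437, class #6 / (E5-F)ₙ producer, route (M) of the (α-0) memo:
# PLANE-WAVE PHASES on the space-time torus, II — the global phase of a CONSERVING momentum string does not depend on the string, and
# the sectorised position kernels of a conserving polynomial are TRANSLATION INVARIANT in norm (bricks M4 (ii)/(iii) of the memo, model-free)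

Cell gate-hubbard-kl, seat hubbard-kl-k3c2-p2 (g11; owner-designate of M1 + M3 of route (M), pen (R59az)).  Continuation of `…EnginePlaneWavePhases`
(one-leg relative phases).  Route (M) needs two more pieces of finite Fourier analysis on `SpaceTimeIdx L M`: the phase strings `∏_i e^{-is_i k_i·x_i}` of two
momentum strings on the CONSERVATION surface (where every kernel of `𝒱ₙ[K]` lives: `kernel_klEffectiveAction_eq_zero_of_freq`, `klEffectiveAction_momentumConserving`)
must be compared leg by leg relative to a reference leg — which needs their global phases at the reference point to agree — and the pin-`0` first moments
of (E4)-type slots must serve every pin `x₁` of the (E5-F) conclusion — which needs translation invariance.  This file: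

* §1 **global phase under conservation**: if the signed frequencies and the signed momenta of `k` sum to zero then at every point
  `∏_i e^{-is_i k_i·x₀} = e^{-i(Σ_i s_i)(π/β)t_{x₀}}` (`prod_hubbardPlaneWave_eq_of_conserving`: the momenta give the trivial character, the fermionic
  frequencies leave their half-integer offsets) — INDEPENDENT of `k`; a phase string factorises through any reference point
  (`prod_hubbardPlaneWave_eq_ref_mul_rel`), hence for two conserving strings with the same charges
  **`‖∏_i e^{-is_i k_i·x_i} − ∏_i e^{-is_i k′_i·x_i}‖ ≤ Σ_i (|ω_{k_i} − ω_{k′_i}| + 2|k⃗_i − k⃗′_i|_𝕋)·spaceTimeDist β (x_i) x_r`** for every reference point `x_r`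
  (`norm_prod_hubbardPlaneWave_sub_le`, `norm_conj_prod_hubbardPlaneWave_sub_le`);
* §2 **translation**: `e^{-isk·(x+a)} = (−1)^{wrap}·e^{-isk·x}·e^{-isk·a}` with the imaginary-time wrap sign INDEPENDENT of `k` (`hubbardPlaneWave_translate`;
  antiperiodicity `e^{isωβ} = −1`, `cexp_chargeSign_mul_matsubaraFreq_mul_beta`); for a frequency- and momentum-conserving `G`,
  `W_Ω(x + a) = (Π wrap signs)·e^{-i(Σ s_i)(π/β)t_a}·W_Ω(x)` (`sectorisedKernel_translate`) and **`‖W_Ω(x + a)‖ = ‖W_Ω(x)‖`** (`norm_sectorisedKernel_translate`);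
  `spaceTimeDist` is translation invariant, symmetric, zero on the diagonal; sums of translation-invariant functions of a tuple reduce to pinned sums
  (`sum_eq_card_mul_sum_pinned`: `Σ_x f x = |Λ|·Σ_y f (x₁ :: y)` for every pin);
The consequences for pinned data (`fixedTupleL1` and the pinned first moments do not depend on the pin) and the momentum-Lipschitz bound of the
kernels are in the companion `…EngineKernelMomentumLipschitz`.

Everything is proved; no definitions; nothing about the model is asserted beyond these identities.
References: BGM 2006 §2.1 (2.2)–(2.5), §2.3 (2.17), §2.7 (2.70)–(2.71) [cite: BenfattoGiulianiMastropietro2006]; Salmhofer 1999 §4.2.4 [cite: Salmhofer1999].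
-/

noncomputable section

namespace Summit.HubbardSuperconductivity.HubbardSuperconductivity.Theorems.EngineV8

set_option linter.dupNamespace false -- summit = problem name (single-conjunct summit), D-0017

open Classical
open Real Finset Complex Literature.MathematicalPhysics.QuantumLattice Literature.Probability.LatticeModels GrassmannAlgebra
open Summit.HubbardSuperconductivity.HubbardSuperconductivity.Theorems.KLProgrammeLegKernels
open Summit.HubbardSuperconductivity.HubbardSuperconductivity.Theorems.KLRegimeSplit
open scoped ComplexConjugate
/-! ## §1 The global phase of a conserving momentum string -/

section Conserving

variable {L M : ℕ} [NeZero L]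

/-- A product of characters in the momentum index is the character of the sum. -/
theorem prod_torusChar_eq_torusChar_sum {d : ℕ} {ι : Type*} (s : Finset ι) (q : ι → TorusSite d L) (x : TorusSite d L) :
    ∏ i ∈ s, torusChar (q i) x = torusChar (∑ i ∈ s, q i) x := by
  induction s using Finset.induction_on with
  | empty => simp
  | insert a s has ih =>
    rw [prod_insert has, sum_insert has, ih, torusChar_comm (q a + _) x, torusChar_add_right, torusChar_comm x, torusChar_comm x]

/-- The spatial factor of a plane wave is the character of MINUS the signed momentum:
`(c = 0 ? conj χ_{k⃗} : χ_{k⃗})(x⃗) = χ_{−signedMomentum c k⃗}(x⃗)`. -/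
theorem planeWave_spatial_eq (c : Fin 2) (k x : TorusSite 2 L) :
    (if c = 0 then conj (torusChar k x) else torusChar k x) = torusChar (-signedMomentum L c k) x := by
  unfold signedMomentum
  split_ifs
  · rw [torusChar_comm, ← torusChar_neg_right, torusChar_comm]
  · rw [neg_neg]

/-- `‖e^{-ir I}‖ = 1` in the cell's sign convention. -/
theorem norm_cexp_neg_ofReal_mul_I (r : ℝ) : ‖Complex.exp (-((r : ℝ) : ℂ) * I)‖ = 1 := by
  rw [← Complex.ofReal_neg, Complex.norm_exp_ofReal_mul_I]

/-- **THE GLOBAL PHASE OF A CONSERVING STRING DOES NOT DEPEND ON THE STRING** (`β ≠ 0`): if the signed frequencies and the signed momenta of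
`k = (k_i)_i` (signs from the charges `c_i`) both sum to zero — the support condition of every kernel of `𝒱ₙ[K]` — then at every point `x₀`
`∏_i e^{-is_i k_i·x₀} = e^{-i(Σ_i s_i)(π/β)t_{x₀}}`: the momenta give the trivial character `χ_{−Σ s_i k⃗_i} = χ_0 = 1`, the frequencies `π(2n_i+1)/β`
leave only their half-integer offsets. -/
theorem prod_hubbardPlaneWave_eq_of_conserving [NeZero M] {β : ℝ} (hβ : β ≠ 0) {m : ℕ} (c : Fin m → Fin 2) (k : Fin m → FreqMomentum L M)
    (x₀ : SpaceTimeIdx L M) (hf : ∑ i, (if c i = 0 then (1 : ℤ) else -1) * matsubaraInt M (k i).1 = 0)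
    (hm : ∑ i, signedMomentum L (c i) (k i).2 = 0) :
    ∏ i, hubbardPlaneWave L M β (c i) (k i) x₀ =
      Complex.exp (-((((∑ i, chargeSign (c i)) * (π / β * imagTime β M x₀.1)) : ℝ) : ℂ) * I) := by
  have hterm : ∀ i, hubbardPlaneWave L M β (c i) (k i) x₀ =
      Complex.exp (-((chargeSign (c i) * (matsubaraFreq β M (k i).1 * imagTime β M x₀.1) : ℝ) : ℂ) * I) *
        torusChar (-signedMomentum L (c i) (k i).2) x₀.2 := fun i => by
    rw [hubbardPlaneWave_eq, planeWave_spatial_eq]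
  rw [prod_congr rfl fun i _ => hterm i, prod_mul_distrib, prod_torusChar_eq_torusChar_sum, sum_neg_distrib, hm, neg_zero,
    torusChar_zero_left, mul_one, ← Complex.exp_sum]
  congr 1
  -- the frequency algebra: `Σ_i s_i ω_i = (π/β)·(2·Σ_i s_i n_i + Σ_i s_i) = (π/β)·Σ_i s_i`
  set T : ℝ := imagTime β M x₀.1 with hT
  have hf' : (∑ i, ((if c i = 0 then (1 : ℤ) else -1 : ℤ) : ℝ) * (matsubaraInt M (k i).1 : ℝ)) = 0 := by exact_mod_cast hf
  have e : ∀ i, -(chargeSign (c i) * (matsubaraFreq β M (k i).1 * T)) =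
      -(2 * π / β * T) * (((if c i = 0 then (1 : ℤ) else -1 : ℤ) : ℝ) * (matsubaraInt M (k i).1 : ℝ)) -
        π / β * T * ((if c i = 0 then (1 : ℤ) else -1 : ℤ) : ℝ) := by
    intro i
    rw [chargeSign_eq_intCast]
    simp only [matsubaraFreq]
    field_simp
    ring
  have hreal : (∑ i, -(chargeSign (c i) * (matsubaraFreq β M (k i).1 * T))) = -((∑ i, chargeSign (c i)) * (π / β * T)) := by
    rw [sum_congr rfl fun i _ => e i, sum_sub_distrib, ← mul_sum, ← mul_sum, hf', mul_zero, zero_sub]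
    simp_rw [chargeSign_eq_intCast]
    ring
  have hc : ∀ i, -((chargeSign (c i) * (matsubaraFreq β M (k i).1 * T) : ℝ) : ℂ) * I =
      (((-(chargeSign (c i) * (matsubaraFreq β M (k i).1 * T))) : ℝ) : ℂ) * I := fun i => by push_cast; ring
  simp_rw [hc]
  rw [← sum_mul, ← Complex.ofReal_sum, hreal]
  push_cast
  ring

/-- Hence **two conserving strings with the same charges have the same global phase** at every point. -/
theorem prod_hubbardPlaneWave_eq_prod_of_conserving [NeZero M] {β : ℝ} (hβ : β ≠ 0) {m : ℕ} (c : Fin m → Fin 2)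
    (k k' : Fin m → FreqMomentum L M) (x₀ : SpaceTimeIdx L M)
    (hf : ∑ i, (if c i = 0 then (1 : ℤ) else -1) * matsubaraInt M (k i).1 = 0) (hm : ∑ i, signedMomentum L (c i) (k i).2 = 0)
    (hf' : ∑ i, (if c i = 0 then (1 : ℤ) else -1) * matsubaraInt M (k' i).1 = 0) (hm' : ∑ i, signedMomentum L (c i) (k' i).2 = 0) :
    ∏ i, hubbardPlaneWave L M β (c i) (k i) x₀ = ∏ i, hubbardPlaneWave L M β (c i) (k' i) x₀ := by
  rw [prod_hubbardPlaneWave_eq_of_conserving hβ c k x₀ hf hm, prod_hubbardPlaneWave_eq_of_conserving hβ c k' x₀ hf' hm']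

omit [NeZero L] in
/-- **A phase string factorises through any reference point**: `∏_i e^{-is_i k_i·x_i} = (∏_i e^{-is_i k_i·x_r})·∏_i ρ_{c_i}(k_i; x_i, x_r)`. -/
theorem prod_hubbardPlaneWave_eq_ref_mul_rel (β : ℝ) {m : ℕ} (c : Fin m → Fin 2) (k : Fin m → FreqMomentum L M)
    (x : Fin m → SpaceTimeIdx L M) (xr : SpaceTimeIdx L M) :
    ∏ i, hubbardPlaneWave L M β (c i) (k i) (x i) =
      (∏ i, hubbardPlaneWave L M β (c i) (k i) xr) * ∏ i, (hubbardPlaneWave L M β (c i) (k i) (x i) * conj (hubbardPlaneWave L M β (c i) (k i) xr)) := by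
  rw [← prod_mul_distrib]
  refine prod_congr rfl fun i _ => ?_
  have hb : hubbardPlaneWave L M β (c i) (k i) xr * conj (hubbardPlaneWave L M β (c i) (k i) xr) = 1 := by
    rw [mul_conj, Complex.normSq_eq_norm_sq, norm_hubbardPlaneWave]; simp
  calc hubbardPlaneWave L M β (c i) (k i) (x i) = hubbardPlaneWave L M β (c i) (k i) (x i) *
        (hubbardPlaneWave L M β (c i) (k i) xr * conj (hubbardPlaneWave L M β (c i) (k i) xr)) := by rw [hb, mul_one]
    _ = _ := by ring

/-- **TWO CONSERVING PHASE STRINGS DIFFER BY AT MOST THE DUAL DISTANCES TIMES THE TORUS DISTANCES TO A REFERENCE LEG** (`0 < β`):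
`‖∏_i e^{-is_i k_i·x_i} − ∏_i e^{-is_i k′_i·x_i}‖ ≤ Σ_i (|ω_{k_i} − ω_{k′_i}| + 2|k⃗_i − k⃗′_i|_𝕋)·spaceTimeDist β (x_i) x_r` for every reference point `x_r` — the global
phases at `x_r` coincide (conservation), and the relative phases are Lipschitz (§2). -/
theorem norm_prod_hubbardPlaneWave_sub_le [NeZero M] {β : ℝ} (hβ : 0 < β) {m : ℕ} (c : Fin m → Fin 2) (k k' : Fin m → FreqMomentum L M)
    (hf : ∑ i, (if c i = 0 then (1 : ℤ) else -1) * matsubaraInt M (k i).1 = 0) (hm : ∑ i, signedMomentum L (c i) (k i).2 = 0)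
    (hf' : ∑ i, (if c i = 0 then (1 : ℤ) else -1) * matsubaraInt M (k' i).1 = 0) (hm' : ∑ i, signedMomentum L (c i) (k' i).2 = 0)
    (x : Fin m → SpaceTimeIdx L M) (xr : SpaceTimeIdx L M) :
    ‖∏ i, hubbardPlaneWave L M β (c i) (k i) (x i) - ∏ i, hubbardPlaneWave L M β (c i) (k' i) (x i)‖ ≤
      ∑ i, (|matsubaraFreq β M (k i).1 - matsubaraFreq β M (k' i).1| + 2 * klTorusNorm L ((k i).2 - (k' i).2)) *
        spaceTimeDist L M β (x i) xr := by
  rw [prod_hubbardPlaneWave_eq_ref_mul_rel β c k x xr, prod_hubbardPlaneWave_eq_ref_mul_rel β c k' x xr,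
    prod_hubbardPlaneWave_eq_prod_of_conserving hβ.ne' c k k' xr hf hm hf' hm', ← mul_sub, norm_mul,
    prod_hubbardPlaneWave_eq_of_conserving hβ.ne' c k' xr hf' hm', norm_cexp_neg_ofReal_mul_I, one_mul]
  have hu : ∀ (q : Fin m → FreqMomentum L M) (i : Fin m), i ∈ univ →
      ‖hubbardPlaneWave L M β (c i) (q i) (x i) * conj (hubbardPlaneWave L M β (c i) (q i) xr)‖ ≤ 1 := fun q i _ => by
    rw [norm_mul, Complex.norm_conj, norm_hubbardPlaneWave, norm_hubbardPlaneWave, mul_one]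
  exact (Literature.NumberTheory.LFunctions.Katai.norm_prod_sub_prod_le _ _ _ (hu k) (hu k')).trans (sum_le_sum fun i _ => norm_relPhase_sub_le_spaceTimeDist hβ (c i) (k i) (k' i) (x i) xr)

/-- The same for the CONJUGATE strings (the form met in the Fourier inversion `sum_sectorisedKernel_mul_conj_prod`). -/
theorem norm_conj_prod_hubbardPlaneWave_sub_le [NeZero M] {β : ℝ} (hβ : 0 < β) {m : ℕ} (c : Fin m → Fin 2) (k k' : Fin m → FreqMomentum L M)
    (hf : ∑ i, (if c i = 0 then (1 : ℤ) else -1) * matsubaraInt M (k i).1 = 0) (hm : ∑ i, signedMomentum L (c i) (k i).2 = 0)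
    (hf' : ∑ i, (if c i = 0 then (1 : ℤ) else -1) * matsubaraInt M (k' i).1 = 0) (hm' : ∑ i, signedMomentum L (c i) (k' i).2 = 0)
    (x : Fin m → SpaceTimeIdx L M) (xr : SpaceTimeIdx L M) :
    ‖conj (∏ i, hubbardPlaneWave L M β (c i) (k i) (x i)) - conj (∏ i, hubbardPlaneWave L M β (c i) (k' i) (x i))‖ ≤
      ∑ i, (|matsubaraFreq β M (k i).1 - matsubaraFreq β M (k' i).1| + 2 * klTorusNorm L ((k i).2 - (k' i).2)) *
        spaceTimeDist L M β (x i) xr := by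
  rw [← map_sub, Complex.norm_conj]
  exact norm_prod_hubbardPlaneWave_sub_le hβ c k k' hf hm hf' hm' x xr

end Conserving

/-! ## §2 Translation -/

section Translation

variable {L M : ℕ} [NeZero L]

omit [NeZero L] in
/-- `e^{is_c ω β I} = −1`: a fermionic frequency times `β` is an odd multiple of `π` (`β ≠ 0`). -/
theorem cexp_chargeSign_mul_matsubaraFreq_mul_beta {β : ℝ} (hβ : β ≠ 0) (c : Fin 2) (i : MatsubaraIdx M) :
    Complex.exp (((chargeSign c * (matsubaraFreq β M i * β) : ℝ) : ℂ) * I) = -1 := by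
  set z : ℤ := (if c = 0 then (1 : ℤ) else -1) * (2 * matsubaraInt M i + 1) with hz
  have hodd : Odd z := by
    rw [hz]
    refine Odd.mul ?_ ⟨matsubaraInt M i, by ring⟩
    split_ifs <;> decide
  have hβ' : (β : ℂ) ≠ 0 := by exact_mod_cast hβ
  have hph : (((chargeSign c * (matsubaraFreq β M i * β) : ℝ) : ℂ) * I) = (z : ℂ) * (π * I) := by
    rw [chargeSign_eq_intCast, hz]
    simp only [matsubaraFreq]
    push_cast
    field_simp
    split_ifs <;> push_cast <;> ring
  rw [hph, Complex.exp_int_mul, Complex.exp_pi_mul_I, hodd.neg_one_zpow]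

/-- **TRANSLATING A PLANE WAVE**: `e^{-is_c k·(x+a)} = (−1)^{wrap}·e^{-is_c k·x}·e^{-is_c k·a}`, where `wrap` records whether the imaginary-time indices
wrap around `2M` (antiperiodicity: `ω β ∈ π(2ℤ+1)`) — a sign that does NOT depend on `k`. -/
theorem hubbardPlaneWave_translate [NeZero M] {β : ℝ} (hβ : β ≠ 0) (c : Fin 2) (k : FreqMomentum L M) (x a : SpaceTimeIdx L M) :
    hubbardPlaneWave L M β c k (x.1 + a.1, x.2 + a.2) =
      (if 2 * M ≤ x.1.val + a.1.val then -1 else 1) * (hubbardPlaneWave L M β c k x * hubbardPlaneWave L M β c k a) := by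
  -- spatial part: characters are exactly multiplicative
  have hsp : (if c = 0 then conj (torusChar k.2 (x.2 + a.2)) else torusChar k.2 (x.2 + a.2)) =
      (if c = 0 then conj (torusChar k.2 x.2) else torusChar k.2 x.2) * (if c = 0 then conj (torusChar k.2 a.2) else torusChar k.2 a.2) := by
    split_ifs
    · rw [torusChar_add_right, map_mul]
    · rw [torusChar_add_right]
  -- time part: the representative of `x₀ + a₀` is `x₀ + a₀` or `x₀ + a₀ − 2M`
  have hM : (0 : ℝ) < M := Nat.cast_pos.2 (Nat.pos_of_ne_zero (NeZero.ne M))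
  have htime : Complex.exp (-((chargeSign c * (matsubaraFreq β M k.1 * imagTime β M (x.1 + a.1)) : ℝ) : ℂ) * I) =
      (if 2 * M ≤ x.1.val + a.1.val then -1 else 1) *
        (Complex.exp (-((chargeSign c * (matsubaraFreq β M k.1 * imagTime β M x.1) : ℝ) : ℂ) * I) *
          Complex.exp (-((chargeSign c * (matsubaraFreq β M k.1 * imagTime β M a.1) : ℝ) : ℂ) * I)) := by
    have hval := Fin.val_add_eq_ite x.1 a.1
    split_ifs at hval ⊢ with hw
    · -- wrap: `t_{x+a} = t_x + t_a − β`, and `e^{is ω β I} = -1`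
      have ht : imagTime β M (x.1 + a.1) = imagTime β M x.1 + imagTime β M a.1 - β := by
        simp only [imagTime]
        rw [hval, Nat.cast_sub hw]
        push_cast
        field_simp
      rw [ht, neg_one_mul, ← Complex.exp_add, ← neg_one_mul (Complex.exp _), ← cexp_chargeSign_mul_matsubaraFreq_mul_beta hβ c k.1,
        ← Complex.exp_add]
      congr 1
      push_cast
      ring
    · have ht : imagTime β M (x.1 + a.1) = imagTime β M x.1 + imagTime β M a.1 := by
        simp only [imagTime]
        rw [hval]
        push_cast
        ring
      rw [ht, one_mul, ← Complex.exp_add]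
      congr 1
      push_cast
      ring
  rw [hubbardPlaneWave_eq, hubbardPlaneWave_eq, hubbardPlaneWave_eq]
  -- `(x.1 + a.1, x.2 + a.2).1 = x.1 + a.1` etc. are `rfl`
  show Complex.exp (-((chargeSign c * (matsubaraFreq β M k.1 * imagTime β M (x.1 + a.1)) : ℝ) : ℂ) * I) *
      (if c = 0 then conj (torusChar k.2 (x.2 + a.2)) else torusChar k.2 (x.2 + a.2)) = _
  rw [htime, hsp]
  ring

/-- **TRANSLATION COVARIANCE OF THE SECTORISED KERNELS OF A CONSERVING POLYNOMIAL**: if every kernel of `G` vanishes off the frequency- and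
momentum-conservation surface (as for `𝒱ₙ[K]`), then translating all legs by `a` multiplies `W_Ω` by a unimodular constant — the product of the legs'
time-wrap signs times the k-independent global phase `e^{-i(Σ_i s_i)(π/β)t_a}` of §1. -/
theorem sectorisedKernel_translate [NeZero M] {N : ℕ} {β : ℝ} (hβ : β ≠ 0) (F : Fin N → FreqMomentum L M → ℂ) (G : HubbardGrassmann L M)
    (hfreq : ∀ (m : ℕ) (X : Fin m → HubbardFieldIdx L M),
      (∑ i, (if (X i).2 = 0 then (1 : ℤ) else -1) * matsubaraInt M (X i).1.1.1) ≠ 0 → kernel ℂ G m X = 0)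
    (hmom : ∀ (m : ℕ) (X : Fin m → HubbardFieldIdx L M), (∑ i, signedMomentum L (X i).2 (X i).1.1.2) ≠ 0 → kernel ℂ G m X = 0)
    (m : ℕ) (Ω : Fin m → SectorLeg N) (x : Fin m → SpaceTimeIdx L M) (a : SpaceTimeIdx L M) :
    sectorisedKernel L M β F G m Ω (fun i => ((x i).1 + a.1, (x i).2 + a.2)) =
      ((∏ i, (if 2 * M ≤ (x i).1.val + a.1.val then (-1 : ℂ) else 1)) *
        Complex.exp (-((((∑ i, chargeSign (Ω i).2) * (π / β * imagTime β M a.1)) : ℝ) : ℂ) * I)) *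
      sectorisedKernel L M β F G m Ω x := by
  rw [sectorisedKernel_def, sectorisedKernel_def, mul_sum]
  refine sum_congr rfl fun k _ => ?_
  by_cases hk : (∑ i, (if (Ω i).2 = 0 then (1 : ℤ) else -1) * matsubaraInt M (k i).1) = 0 ∧ ∑ i, signedMomentum L (Ω i).2 (k i).2 = 0
  · simp_rw [hubbardPlaneWave_translate hβ]
    have hre : ∀ i, F (Ω i).1.1 (k i) * ((if 2 * M ≤ (x i).1.val + a.1.val then -1 else 1) *
        (hubbardPlaneWave L M β (Ω i).2 (k i) (x i) * hubbardPlaneWave L M β (Ω i).2 (k i) a)) =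
        ((if 2 * M ≤ (x i).1.val + a.1.val then (-1 : ℂ) else 1) * hubbardPlaneWave L M β (Ω i).2 (k i) a) *
          (F (Ω i).1.1 (k i) * hubbardPlaneWave L M β (Ω i).2 (k i) (x i)) := fun i => by ring
    rw [prod_congr rfl fun i _ => hre i, prod_mul_distrib, prod_mul_distrib,
      prod_hubbardPlaneWave_eq_of_conserving hβ (fun i => (Ω i).2) k a hk.1 hk.2]
    ring
  · -- off the conservation surface the kernel vanishes
    have h0 : kernel ℂ G m (fun i => ((k i, (Ω i).1.2), (Ω i).2)) = 0 := by
      rcases not_and_or.1 hk with h | h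
      · exact hfreq m _ (by simpa using h)
      · exact hmom m _ (by simpa using h)
    rw [h0, mul_zero, mul_zero, mul_zero]

/-- **`‖W_Ω(x + a)‖ = ‖W_Ω(x)‖`** for a conserving polynomial. -/
theorem norm_sectorisedKernel_translate [NeZero M] {N : ℕ} {β : ℝ} (hβ : β ≠ 0) (F : Fin N → FreqMomentum L M → ℂ) (G : HubbardGrassmann L M)
    (hfreq : ∀ (m : ℕ) (X : Fin m → HubbardFieldIdx L M),
      (∑ i, (if (X i).2 = 0 then (1 : ℤ) else -1) * matsubaraInt M (X i).1.1.1) ≠ 0 → kernel ℂ G m X = 0)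
    (hmom : ∀ (m : ℕ) (X : Fin m → HubbardFieldIdx L M), (∑ i, signedMomentum L (X i).2 (X i).1.1.2) ≠ 0 → kernel ℂ G m X = 0)
    (m : ℕ) (Ω : Fin m → SectorLeg N) (x : Fin m → SpaceTimeIdx L M) (a : SpaceTimeIdx L M) :
    ‖sectorisedKernel L M β F G m Ω (fun i => ((x i).1 + a.1, (x i).2 + a.2))‖ = ‖sectorisedKernel L M β F G m Ω x‖ := by
  rw [sectorisedKernel_translate hβ F G hfreq hmom m Ω x a, norm_mul, norm_mul, norm_cexp_neg_ofReal_mul_I, mul_one, norm_prod]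
  have h1 : ∏ i, ‖(if 2 * M ≤ (x i).1.val + a.1.val then (-1 : ℂ) else 1)‖ = 1 := prod_eq_one fun i _ => by split_ifs <;> simp
  rw [h1, one_mul]

/-- The route's `circDist` is translation invariant on `ℤ/N` (read through `Fin N`). -/
theorem circDist_fin_add (N : ℕ) [NeZero N] (i j a : Fin N) : circDist N (i + a).val (j + a).val = circDist N i.val j.val := by
  have h : ∀ u v : Fin N, (((u + v).val : ℕ) : ZMod N) = ((u.val : ℕ) : ZMod N) + ((v.val : ℕ) : ZMod N) := by
    intro u v
    rw [Fin.val_add, ZMod.natCast_mod, Nat.cast_add]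
  have hr : (circDist N (i + a).val (j + a).val : ℝ) = (circDist N i.val j.val : ℝ) := by
    rw [circDist_cast_eq_abs_valMinAbs, circDist_cast_eq_abs_valMinAbs, h, h, add_sub_add_right_eq_sub]
  exact_mod_cast hr

/-- The route's `circDist` is translation invariant on `ZMod L`. -/
theorem circDist_zmod_add {L : ℕ} [NeZero L] (u v w : ZMod L) : circDist L (u + w).val (v + w).val = circDist L u.val v.val := by
  rw [circDist_val_eq, circDist_val_eq]
  congr 1 <;> congr 1 <;> ring

/-- **`spaceTimeDist` is translation invariant.** -/
theorem spaceTimeDist_translate [NeZero M] (β : ℝ) (x y a : SpaceTimeIdx L M) :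
    spaceTimeDist L M β (x.1 + a.1, x.2 + a.2) (y.1 + a.1, y.2 + a.2) = spaceTimeDist L M β x y := by
  haveI : NeZero (2 * M) := ⟨by have := NeZero.ne M; omega⟩
  unfold KLRegimeSplit.spaceTimeDist
  simp only [Pi.add_apply, circDist_fin_add, circDist_zmod_add]

omit [NeZero L] in
/-- `spaceTimeDist` is symmetric. -/
theorem spaceTimeDist_comm (β : ℝ) (x y : SpaceTimeIdx L M) : spaceTimeDist L M β x y = spaceTimeDist L M β y x := by
  unfold KLRegimeSplit.spaceTimeDist
  rw [circDist_comm (2 * M), circDist_comm L (x.2 0).val, circDist_comm L (x.2 1).val]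

/-- `spaceTimeDist x x = 0`. -/
theorem spaceTimeDist_self [NeZero M] (β : ℝ) (x : SpaceTimeIdx L M) : spaceTimeDist L M β x x = 0 := by
  haveI : NeZero (2 * M) := ⟨by have := NeZero.ne M; omega⟩
  have h0 : ∀ (N a : ℕ) [NeZero N], circDist N a a = 0 := fun N a _ => by
    rw [circDist_eq_min_val, sub_self, ZMod.val_zero, Nat.zero_min]
  unfold KLRegimeSplit.spaceTimeDist
  rw [h0, h0, h0]
  simp

omit [NeZero L] in
/-- Translating a pinned tuple `x₀ :: y` is pinning at `x₀ + a` the translated free legs. -/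
theorem translate_vecCons {m : ℕ} (x₀ : SpaceTimeIdx L M) (y : Fin m → SpaceTimeIdx L M) (a : SpaceTimeIdx L M) :
    (fun i => ((Matrix.vecCons x₀ y i).1 + a.1, (Matrix.vecCons x₀ y i).2 + a.2)) =
      Matrix.vecCons ((x₀.1 + a.1, x₀.2 + a.2) : SpaceTimeIdx L M) (fun j => ((y j).1 + a.1, (y j).2 + a.2)) := by
  funext i
  refine Fin.cases ?_ (fun j => ?_) i
  · simp
  · simp

/-- **SUMS OF TRANSLATION-INVARIANT FUNCTIONS REDUCE TO PINNED SUMS**: if `f(x + a) = f(x)` for all tuples `x` and shifts `a`, then for every pin `x₁`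
`Σ_{x : Fin (m+1) → Λ} f x = |Λ|·Σ_{y : Fin m → Λ} f (x₁ :: y)`. -/
theorem sum_eq_card_mul_sum_pinned [NeZero M] {m : ℕ} (f : (Fin (m + 1) → SpaceTimeIdx L M) → ℝ)
    (hf : ∀ (x : Fin (m + 1) → SpaceTimeIdx L M) (a : SpaceTimeIdx L M), f (fun i => ((x i).1 + a.1, (x i).2 + a.2)) = f x)
    (x₁ : SpaceTimeIdx L M) :
    ∑ x : Fin (m + 1) → SpaceTimeIdx L M, f x = Fintype.card (SpaceTimeIdx L M) * ∑ y : Fin m → SpaceTimeIdx L M, f (Matrix.vecCons x₁ y) := by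
  haveI : NeZero (2 * M) := ⟨by have := NeZero.ne M; omega⟩
  -- split off leg `0`
  have hsplit : ∑ x : Fin (m + 1) → SpaceTimeIdx L M, f x =
      ∑ x₀ : SpaceTimeIdx L M, ∑ y : Fin m → SpaceTimeIdx L M, f (Matrix.vecCons x₀ y) := by
    rw [← (Fin.consEquiv fun _ : Fin (m + 1) => SpaceTimeIdx L M).sum_comp, Fintype.sum_prod_type]
    rfl
  rw [hsplit]
  -- every slice equals the slice at `x₁`
  have hslice : ∀ x₀ : SpaceTimeIdx L M, ∑ y : Fin m → SpaceTimeIdx L M, f (Matrix.vecCons x₀ y) = ∑ y : Fin m → SpaceTimeIdx L M, f (Matrix.vecCons x₁ y) := by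
    intro x₀
    set a : SpaceTimeIdx L M := (x₁.1 - x₀.1, x₁.2 - x₀.2) with ha
    have hx : ((x₀.1 + a.1, x₀.2 + a.2) : SpaceTimeIdx L M) = x₁ := by
      rw [ha]; ext <;> simp
    -- translate by `a`, then reindex the free legs by `y ↦ y + a`
    have h1 : ∀ y : Fin m → SpaceTimeIdx L M, f (Matrix.vecCons x₀ y) = f (Matrix.vecCons x₁ (fun j => ((y j).1 + a.1, (y j).2 + a.2))) := by
      intro y
      rw [← hf (Matrix.vecCons x₀ y) a, translate_vecCons, hx]
    simp_rw [h1]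
    exact Fintype.sum_equiv (Equiv.addRight (fun _ : Fin m => a)) _ _ fun y => by
      simp only [Equiv.coe_addRight]
      rfl
  simp_rw [hslice]
  rw [sum_const, card_univ, nsmul_eq_mul]

end Translation

end Summit.HubbardSuperconductivity.HubbardSuperconductivity.Theorems.EngineV8

end
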